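import Summits.BirchSwinnertonDyer.Rank1Residual.Supersingular.KuriharaTwistRecordAssemblyLValues
import Literature.NumberTheory.EllipticCurves.ComplexMultiplication
import HarnessLib

/-!
# `r_an(E) = 0` FROM THE ENGINE'S OWN ENCLOSURE: the data binder `hr0 : W.analyticRank = 0` of every
# depth-one Kurihara OFFER (`X6KuriharaOfferShape*`, `X7KuriharaOfferShape`) is a CONSEQUENCE of its
# `L`-value enclosure `hballL` and the recorded integers — no table lookup

Cell `b2b-bsdres`, supersingular family, prover A = unit `b2b-bsdres-x10b` (gen 21).  Topic file; namespace
`Summit.BirchSwinnertonDyer.Rank1Residual.Supersingular`.  THEOREMS ONLY (no definition, no named fact,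
nothing asserted about any curve, nothing booked); X6 / X7 stay CONSTRUCTION-SHAPED (RESIDUAL-MAP §I N4 / N5).

HONEST FRAMING (run/shared/lean/b2b/bsd-rank1-residual/, verbatim in every file): the goal of the
cell is to DELETE the COMBINATION-SHAPED residual classes of the Birch–Swinnerton-Dyer formula for
ALL analytic-rank `≤ 1` elliptic curves over `ℚ` — "full BSD formula for every rank `≤ 1` curve in
class `C`" assembled STRICTLY from published theorems — so that the rank-`≤ 1` remainder becomes
exactly the CONSTRUCTION-SHAPED classes, which are TYPED (missing-input `Prop`s), NOT attempted.
This is not "finishing BSD".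

## What this file proves

Every N4 / N5 Kurihara offer of record (`bsdp_x6r0t_…`, `bsdp_x6r0ct_…`, `bsdp_x7r0…t_…`; x10b gens 12–20)
concludes `BSDp W p` from the named facts `hKim`, `hϖ`, `hGZK`, `hmod`, the newform `f` (`hf`), the DATA binder
`hr0 : W.analyticRank = 0` (so far: Cremona's `allbsd` table) and the engine's enclosure `hballL`: for every
family `L_j` of entire continuations of `L(f, χ_j⁻¹, s)` and every `k < p`, a ball of radius `≤ R` whose centre is
within `Mr` of the recorded INTEGER `b_k = binsStar[k]` contains
`Q_k = D'·(c_∞·re(A·L(E,1) + Σ_{j≠0} e_p(−jk)·τ(χ_j)·L_j(1)) / (q·Ω⁺_f))`.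

* `sum_range_stdAddChar_neg_mul_eq_zero` — `Σ_{k<p} e_p(−j·k) = 0` for `j ≠ 0` (orthogonality; Mathlib
  `AddChar.sum_mulShift` for the primitive character `ZMod.stdAddChar`).
* **`entireLFunction_one_ne_zero_of_LValueBall`** — summing the `p` enclosures: `Σ_k Q_k =
  D'·c_∞·A·re L(E,1)·p/(q·Ω⁺_f)` (the twisted terms cancel by orthogonality), so IF `L(E,1) = 0` then
  `|Σ_k b_k| ≤ p·(R + Mr)`; hence `p·(R + Mr) < 1` (every rounding certificate of record has `8p(R+Mr) < 1`)
  and `Σ_{k<p} b_k ≠ 0` (decidable on the record) give `L(E,1) ≠ 0`.  The continuations `L_j` at which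
  `hballL` is instantiated are the tree's `exists_differentiable_eq_twistedLSeries_holds` (proved).  No
  hypothesis on `D'`, `c_∞`, `q`, `Ω⁺_f`, `A` is needed (if any of them vanishes every `Q_k` is `0` and the
  same contradiction follows).
* `L(E,1) ≠ 0 ⟹ r_an(E) = 0` UNCONDITIONALLY is the tree's
  `Literature.NumberTheory.EllipticCurves.analyticRank_eq_zero_of_entireLFunction_one_ne_zero`
  (`ComplexMultiplication.lean`; Mathlib `analyticOrderAt_eq_zero`), imported.
* **`analyticRank_eq_zero_of_LValueBall`** — the composition, with the hypothesis `hballL` in the LITERAL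
  shape of the landed records (`ZMod p`-indexed family, `gaussSum (binChar n ψ j) stdAddChar`, casts as
  recorded), so that a record discharges its `hr0` by ONE application to its own `hballL`.

Consequence (records `X6KuriharaOfferRanCert*`, `X7KuriharaOfferRanCert*`, gen 21): the binders of an
N4 / N5 offer become EXACTLY {`hKim`, `hϖ`, `hGZK`, `hmod`} (published), the newform `f` (`hf`), and the
two-engine enclosure `hballL` — no database entry.  Per pair; NOT a class theorem; nothing booked.

References: `KuriharaTwistRecordAssemblyLValues.lean`, `X6KuriharaOfferShape.lean` (gen 12);
B. Birch, H. P. F. Swinnerton-Dyer, J. reine angew. Math. 218 (1965) [BirchSwinnertonDyer1965];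
Mazur–Tate–Teitelbaum, Invent. Math. 84 (1986) §I.8 [MazurTateTeitelbaum1986Invent];
J. E. Cremona, *Algorithms for modular elliptic curves* (1997) §2.8 [CremonaAlgorithms1997].
-/

set_option autoImplicit false

noncomputable section

open scoped Classical MatrixGroups ModularForm

open CongruenceSubgroup WeierstrassCurve Literature.NumberTheory.EllipticCurves
  Literature.NumberTheory.EllipticCurves.ModularForms
  Summit.BirchSwinnertonDyer.Rank1Residual.Supersingular.KuriharaTwist

namespace Summit.BirchSwinnertonDyer.Rank1Residual.Supersingular

/-- **Orthogonality**: `Σ_{k < M} e_M(−(j·k)) = 0` for `j ≠ 0` in `ℤ/M` — the `k < M` (naturals, cast)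
run over `ℤ/M` once each, and `x ↦ e_M(x·(−j))` is a non-trivial character because `e_M` is primitive
(Mathlib `ZMod.isPrimitive_stdAddChar`, `AddChar.sum_mulShift`). [folklore] -/
theorem sum_range_stdAddChar_neg_mul_eq_zero {M : ℕ} [NeZero M] {j : ZMod M} (hj : j ≠ 0) :
    ∑ k ∈ Finset.range M, ZMod.stdAddChar (-(j * (k : ZMod M))) = 0 := by
  have h1 : ∑ k ∈ Finset.range M, ZMod.stdAddChar (-(j * (k : ZMod M))) =
      ∑ x : ZMod M, ZMod.stdAddChar (x * -j) := by
    refine Finset.sum_nbij' (fun k => (k : ZMod M)) (fun x => x.val) (fun _ _ => Finset.mem_univ _)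
      (fun x _ => Finset.mem_range.mpr (ZMod.val_lt x))
      (fun k hk => ZMod.val_cast_of_lt (Finset.mem_range.mp hk))
      (fun x _ => ZMod.natCast_zmod_val x) fun k _ => by rw [mul_neg, mul_comm]
  rw [h1, AddChar.sum_mulShift (-j) (ZMod.isPrimitive_stdAddChar M), if_neg (neg_ne_zero.mpr hj), Nat.cast_zero]

/-- **`L(E,1) ≠ 0` FROM THE ENCLOSURE OF A DEPTH-ONE KURIHARA RECORD.**  Hypotheses: the engine's enclosure
`hballL` in the literal shape of the landed offers (a `ZMod M`-indexed family of twisted continuations,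
`M = p`; any reals `R`, `Mr`, `D`, `c`, `q`, any integer `A`, any list `bins`), `M·(R + Mr) < 1`, and
`Σ_{k<M} bins[k] ≠ 0`.  Proof: instantiate `hballL` at the tree's continuations
(`exists_differentiable_eq_twistedLSeries_holds`); if `L(E,1) = 0`, the sum over `k < M` of the enclosed
quantities is `D·(c·re(Σ_k Σ_{j≠0} e_M(−jk)·τ_j·L_j(1))/(q·Ω⁺_f)) = 0` by `sum_range_stdAddChar_neg_mul_eq_zero`,
so `|Σ_k bins[k]| ≤ Σ_k (Mr + R) < 1`, i.e. the integer `Σ_k bins[k]` is `0`.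
[cite: MazurTateTeitelbaum1986Invent, §I.8 (8.6)] [cite: CremonaAlgorithms1997, §2.8 (2.8.8) (PDF p. 26)] -/
theorem entireLFunction_one_ne_zero_of_LValueBall {N : ℕ} [NeZero N] (f : CuspForm (Gamma0 N) 2)
    {W : WeierstrassCurve ℚ} {M : ℕ} [NeZero M] (n : ℕ) [NeZero n]
    (ψ : (ℓ : ℕ) → (ZMod ℓ)ˣ →* Multiplicative (ZMod M))
    (R Mr D c q : ℝ) (bins : List ℤ) (A : ℤ)
    (hsmall : (M : ℝ) * (R + Mr) < 1)
    (hsum : ∑ k ∈ Finset.range M, bins.getD k 0 ≠ 0)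
    (hballL : ∀ (L : ZMod M → ℂ → ℂ), (∀ j, j ≠ 0 → Differentiable ℂ (L j)) →
      (∀ j, j ≠ 0 → ∀ s : ℂ, 2 < s.re → L j s = twistedLSeries f (binChar n ψ j)⁻¹ s) →
      ∀ k < M, ∃ mid rad : ℝ, rad ≤ R ∧ |mid - ((bins.getD k 0 : ℤ) : ℝ)| ≤ Mr ∧
        |D * (c * ((((A : ℤ) : ℂ) * W.entireLFunction 1 +
            ∑ j ∈ (Finset.univ : Finset (ZMod M)).erase 0,
              ZMod.stdAddChar (-(j * (k : ZMod M))) *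
                (gaussSum (binChar n ψ j) (ZMod.stdAddChar (N := n)) * L j 1)).re /
            (q * plusPeriod f))) - mid| ≤ rad) :
    W.entireLFunction 1 ≠ 0 := by
  intro hL0
  -- the tree's entire continuations of the `L(f, χ_j⁻¹, s)`
  choose L hL using fun j : ZMod M =>
    exists_differentiable_eq_twistedLSeries_holds f (m := n) (binChar n ψ j)⁻¹
  -- the twisted part of the `k`-th enclosed quantity, and its vanishing total
  set S : ℕ → ℂ := fun k => ∑ j ∈ (Finset.univ : Finset (ZMod M)).erase 0,
      ZMod.stdAddChar (-(j * (k : ZMod M))) *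
        (gaussSum (binChar n ψ j) (ZMod.stdAddChar (N := n)) * L j 1) with hS
  have hSsum : ∑ k ∈ Finset.range M, S k = 0 := by
    simp only [hS]
    rw [Finset.sum_comm]
    refine Finset.sum_eq_zero fun j hj => ?_
    rw [← Finset.sum_mul, sum_range_stdAddChar_neg_mul_eq_zero (Finset.mem_erase.mp hj).1, zero_mul]
  -- each recorded integer is within `R + Mr` of `D·(c·(re S_k/(q·Ω)))`
  have hQ : ∀ k ∈ Finset.range M,
      |((bins.getD k 0 : ℤ) : ℝ) - D * (c * ((S k).re / (q * plusPeriod f)))| ≤ R + Mr := by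
    intro k hk
    obtain ⟨mid, rad, h1, h2, h3⟩ :=
      hballL L (fun j _ => (hL j).1) (fun j _ => (hL j).2) k (Finset.mem_range.mp hk)
    rw [hL0, mul_zero, zero_add] at h3
    calc |((bins.getD k 0 : ℤ) : ℝ) - D * (c * ((S k).re / (q * plusPeriod f)))|
        = |(((bins.getD k 0 : ℤ) : ℝ) - mid) -
            (D * (c * ((S k).re / (q * plusPeriod f))) - mid)| := by ring_nf
      _ ≤ |((bins.getD k 0 : ℤ) : ℝ) - mid| + |D * (c * ((S k).re / (q * plusPeriod f))) - mid| :=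
          abs_sub _ _
      _ ≤ Mr + R := add_le_add (by rwa [abs_sub_comm]) (h3.trans h1)
      _ = R + Mr := add_comm _ _
  -- the total of the `D·(c·(re S_k/(q·Ω)))` vanishes
  have htot : ∑ k ∈ Finset.range M, D * (c * ((S k).re / (q * plusPeriod f))) = 0 := by
    rw [← Finset.mul_sum, ← Finset.mul_sum, ← Finset.sum_div, ← Complex.re_sum, hSsum,
      Complex.zero_re, zero_div, mul_zero, mul_zero]
  -- so the integer `Σ_k bins[k]` has absolute value `< 1`
  have hlt : |((∑ k ∈ Finset.range M, bins.getD k 0 : ℤ) : ℝ)| < 1 := by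
    calc |((∑ k ∈ Finset.range M, bins.getD k 0 : ℤ) : ℝ)|
        = |∑ k ∈ Finset.range M,
            (((bins.getD k 0 : ℤ) : ℝ) - D * (c * ((S k).re / (q * plusPeriod f))))| := by
          rw [Finset.sum_sub_distrib, htot, sub_zero, Int.cast_sum]
      _ ≤ ∑ k ∈ Finset.range M,
            |((bins.getD k 0 : ℤ) : ℝ) - D * (c * ((S k).re / (q * plusPeriod f)))| :=
          Finset.abs_sum_le_sum_abs _ _
      _ ≤ ∑ _k ∈ Finset.range M, (R + Mr) := Finset.sum_le_sum hQ
      _ = (M : ℝ) * (R + Mr) := by rw [Finset.sum_const, Finset.card_range, nsmul_eq_mul]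
      _ < 1 := hsmall
  have hz : |∑ k ∈ Finset.range M, bins.getD k 0| < 1 := by exact_mod_cast hlt
  exact hsum (Int.abs_lt_one_iff.mp hz)

/-- **`r_an(E) = 0` FROM THE ENCLOSURE OF A DEPTH-ONE KURIHARA RECORD** — the binder `hr0` of the landed
N4 / N5 offers DISCHARGED: `entireLFunction_one_ne_zero_of_LValueBall` followed by
`Literature.….analyticRank_eq_zero_of_entireLFunction_one_ne_zero` (imported).  Side goals on a record: `M·(R + Mr) < 1`
(`norm_num`) and `Σ_{k<M} binsStar[k] ≠ 0` (`decide`).  Per pair; nothing booked.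
[cite: BirchSwinnertonDyer1965] [cite: MazurTateTeitelbaum1986Invent, §I.8 (8.6)] -/
theorem analyticRank_eq_zero_of_LValueBall {N : ℕ} [NeZero N] (f : CuspForm (Gamma0 N) 2)
    {W : WeierstrassCurve ℚ} {M : ℕ} [NeZero M] (n : ℕ) [NeZero n]
    (ψ : (ℓ : ℕ) → (ZMod ℓ)ˣ →* Multiplicative (ZMod M))
    (R Mr D c q : ℝ) (bins : List ℤ) (A : ℤ)
    (hsmall : (M : ℝ) * (R + Mr) < 1)
    (hsum : ∑ k ∈ Finset.range M, bins.getD k 0 ≠ 0)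
    (hballL : ∀ (L : ZMod M → ℂ → ℂ), (∀ j, j ≠ 0 → Differentiable ℂ (L j)) →
      (∀ j, j ≠ 0 → ∀ s : ℂ, 2 < s.re → L j s = twistedLSeries f (binChar n ψ j)⁻¹ s) →
      ∀ k < M, ∃ mid rad : ℝ, rad ≤ R ∧ |mid - ((bins.getD k 0 : ℤ) : ℝ)| ≤ Mr ∧
        |D * (c * ((((A : ℤ) : ℂ) * W.entireLFunction 1 +
            ∑ j ∈ (Finset.univ : Finset (ZMod M)).erase 0,
              ZMod.stdAddChar (-(j * (k : ZMod M))) *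
                (gaussSum (binChar n ψ j) (ZMod.stdAddChar (N := n)) * L j 1)).re /
            (q * plusPeriod f))) - mid| ≤ rad) :
    W.analyticRank = 0 :=
  Literature.NumberTheory.EllipticCurves.analyticRank_eq_zero_of_entireLFunction_one_ne_zero W
    (entireLFunction_one_ne_zero_of_LValueBall f n ψ R Mr D c q bins A hsmall hsum hballL)

end Summit.BirchSwinnertonDyer.Rank1Residual.Supersingular

end
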